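/-
Copyright (c) 2026 the pub-hodgecm-mathlib formalisation cell (harness21).  Prover seat hodgecm-mathlib-K2Liu-p14 (g2): Track B «K2-LIT»,
hLiu418 = stmt-HodgeConjecture-24832; K2E5-plan (g7) 10:32:10Z «(β4-v) IS YOURS» (LEAD F0P6-plan lineage RULINGS M-157b (β4)∕(β5), M-157d (K∞-str)), file (β4-v) D1.
-/
import Summits.HodgeConjecture.HodgeConjecture.Theorems.K2LiuGL2GodementSectionOfFlatArchCM             -- ★ (β4-iv) B
import Summits.HodgeConjecture.HodgeConjecture.Theorems.K2LiuUnitaryMixedSpaceFiniteFunctionsPolynomial  -- ★ (β4-v) C (the polynomial face)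
import Summits.HodgeConjecture.HodgeConjecture.Theorems.K2LiuMiddleCellGodementJunction                 -- ★ junction §1 `exists_finsupp_eval_eq`
import HarnessLib

/-!
# Crux `HLiu418`, road `K2_Liu`, Road Φ organ G5 (β) «Godement sections exhaust», file (β4-v) D1:
# THE ARCHIMEDEAN GODEMENT PACKAGE OF A FINITE-DIMENSIONAL FLAT `K_∞`-STABLE SPACE OF FUNCTIONS ON `K_∞ = U(2, mixedSpace L)`

Cell `hodgecm-mathlib`, crux item hLiu418 = `stmt-HodgeConjecture-24832`; prover K2Liu-p14 (g2).  THEOREMS ONLY (no `def`, no instance, no notation,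
no named-fact hypothesis, no `sorry`); lane `--supports stmt-HodgeConjecture-24832` (count-neutral helper).  `L` totally complex.
INPUT: a finite-dimensional space `W` of functions on `K_∞ = U(2, mixedSpace L)` which is right-`K_∞`-stable and consists of continuous FLAT functions
(`g (p k) = g k` for `p ∈ B ∩ K_∞`) — in (β4-v) D2 this is the span of the archimedean slices `u ↦ B(ι_∞ u · k₀)`, `k₀ ∈ K`, of a flat `K`-finite `B` on
`K = K_∞·GL₂(𝒪̂_L)`.  OUTPUT (**`exists_basis_godement_data`**): a basis `e_i` of `W` (as functions), coordinate functionals written as FINITE COMBINATIONS OF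
EVALUATIONS `c_i : K_∞ →₀ ℂ` (★ junction §1 `K2LiuMiddleCellGodementJunction.exists_finsupp_eval_eq`; so `g = Σ_i (Σ_x c_i(x) g(x)) e_i` for every `g ∈ W` — this is
what makes the finite-adelic coefficients of D2 inherit the invariances of `B`), and for every `i` the ARCHIMEDEAN GODEMENT DATA of `e_i`: finitely many monomial ×
Gaussian Schwartz data `Φ_{i,m}` with ENTIRE inverse coefficients `(A_{i,m} w)⁻¹`, integrable integrands and
`e_i(k) = Σ_m (A_{i,m} w)⁻¹ ∫_{K_∞ˣ} Φ_{i,m}(x · e₂ k) N(x)^w dμ(x)` (`0 < re w`, `k ∈ K_∞`) — ★ (β4-v) C `exists_mvPolynomial_of_finiteDimensional_span_rightTranslates_mixedSpace`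
(the polynomial face of `e_i`: `e_i ∈ W` is continuous and `K_∞`-finite because `W` is right-stable) fed into ★ (β4-iv) B `exists_godement_arch_of_flat_polynomial_cm`.
[cite: JacquetLanglands1970, §5–§6] [cite: MoeglinWaldspurger1995, II.1.7] [cite: BrockerTomDieck1985, III (1.5)] [cite: Bump1997, §3.7].
HONEST LABEL.  `HC_CM` is proved only modulo the 7 printed citations (2 remaining named inputs: hLiu418 = `stmt-HodgeConjecture-24832`,
h413 = `stmt-HodgeConjecture-24833`) until rung 0 closes.
-/

set_option autoImplicit false
set_option linter.dupNamespace false -- the mandated namespace repeats `HodgeConjecture.HodgeConjecture`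

noncomputable section

open MeasureTheory Measure NumberField NumberField.InfinitePlace NumberField.mixedEmbedding MvPolynomial
open scoped NNReal ENNReal Classical ComplexConjugate
open Literature.NumberTheory.Automorphic
open Summit.HodgeConjecture.HodgeConjecture.Cruxes.HLiu418.K2LiuGL2GodementSectionOfFlatArchCM
open Summit.HodgeConjecture.HodgeConjecture.Cruxes.HLiu418.K2LiuUnitaryMixedSpaceFiniteFunctionsPolynomial
open Summit.HodgeConjecture.HodgeConjecture.Cruxes.HLiu418.K2LiuMiddleCellGodementJunction (exists_finsupp_eval_eq)

namespace Summit.HodgeConjecture.HodgeConjecture.Cruxes.HLiu418.K2LiuUnitaryFlatSpaceGodementData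

variable {L : Type} [Field L] [NumberField L] [IsTotallyComplex L]

/-! ## §1 Coordinates in a finite-dimensional space of functions as finite combinations of evaluations -/

omit [NumberField L] [IsTotallyComplex L] in
/-- **a basis of `W` with its coordinate functionals written through evaluations**: `g = Σ_i (Σ_x c_i(x) g(x)) · e_i` for every `g ∈ W`
(★ junction §1 `exists_finsupp_eval_eq`). [cite: MoeglinWaldspurger1995, II.1.7] -/
theorem exists_basis_eval_coords {κ : Type*} (W : Submodule ℂ (κ → ℂ)) [FiniteDimensional ℂ W] :
    ∃ (N : ℕ) (e : Fin N → κ → ℂ) (c : Fin N → (κ →₀ ℂ)), (∀ i, e i ∈ W) ∧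
      ∀ g ∈ W, ∀ k, g k = ∑ i, ((c i).sum fun x a => a * g x) * e i k := by
  set bW := Module.finBasis ℂ W with hbW
  choose c hc using fun i => exists_finsupp_eval_eq W (bW.coord i)
  refine ⟨Module.finrank ℂ W, fun i => (bW i : κ → ℂ), c, fun i => (bW i).2, fun g hg k => ?_⟩
  have hrepr := bW.sum_repr ⟨g, hg⟩
  have hcoe := congrArg (fun w : W => (w : κ → ℂ) k) hrepr
  simp only [Submodule.coe_sum, Submodule.coe_smul, Finset.sum_apply, Pi.smul_apply, smul_eq_mul] at hcoe
  rw [← hcoe]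
  refine Finset.sum_congr rfl fun i _ => ?_
  rw [← Module.Basis.coord_apply, hc i]

/-! ## §2 The archimedean Godement package of a flat right-stable space -/

/-- **THE ARCHIMEDEAN GODEMENT PACKAGE OF A FINITE-DIMENSIONAL FLAT RIGHT-`K_∞`-STABLE SPACE `W` OF CONTINUOUS FUNCTIONS ON `K_∞ = U(2, mixedSpace L)`**
(totally complex `L`; any Haar `μ` on `K_∞ˣ`): a basis `e_i` of `W`, evaluation coordinates `c_i` (`g = Σ_i (Σ_x c_i(x) g(x)) e_i` on `W`), and for each `i` finitely
many Schwartz data `Φ_{i,m}` ((β4-iv) A: monomial × Gaussian), coefficients `A_{i,m}` with ENTIRE inverses, `μ`-integrable integrands, and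
`e_i(k) = Σ_{m ∈ ι_i} (A_{i,m} w)⁻¹ ∫_{K_∞ˣ} Φ_{i,m}(x · e₂ k) N(x)^w dμ(x)` for `0 < re w`, `k ∈ K_∞` — ★ (β4-v) C (polynomial face of the continuous `K_∞`-finite `e_i`) into
★ (β4-iv) B.  [cite: JacquetLanglands1970, §5–§6] [cite: BrockerTomDieck1985, III (1.5) and Thm. (3.1)] [cite: Bump1997, §3.7] [cite: Tate1950, §2.5] -/
theorem exists_basis_godement_data (μ : Measure (mixedSpace L)ˣ) [μ.IsHaarMeasure]
    (W : Submodule ℂ (Matrix.unitaryGroup (Fin 2) (mixedSpace L) → ℂ)) [FiniteDimensional ℂ W]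
    (hright : ∀ g ∈ W, ∀ u₀ : Matrix.unitaryGroup (Fin 2) (mixedSpace L), (fun u => g (u * u₀)) ∈ W)
    (hcont : ∀ g ∈ W, Continuous g)
    (hflat : ∀ g ∈ W, ∀ p k : Matrix.unitaryGroup (Fin 2) (mixedSpace L), (p : Matrix (Fin 2) (Fin 2) (mixedSpace L)) 1 0 = 0 → g (p * k) = g k) :
    ∃ (N : ℕ) (e : Fin N → Matrix.unitaryGroup (Fin 2) (mixedSpace L) → ℂ) (c : Fin N → (Matrix.unitaryGroup (Fin 2) (mixedSpace L) →₀ ℂ))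
      (ι : Fin N → Finset ((({v : InfinitePlace L // v.IsComplex} × Fin 2) ⊕ ({v : InfinitePlace L // v.IsComplex} × Fin 2)) →₀ ℕ))
      (Φ : Fin N → ((({v : InfinitePlace L // v.IsComplex} × Fin 2) ⊕ ({v : InfinitePlace L // v.IsComplex} × Fin 2)) →₀ ℕ) →
        SchwartzMap (Fin 2 → mixedSpace L) ℂ)
      (A : Fin N → ((({v : InfinitePlace L // v.IsComplex} × Fin 2) ⊕ ({v : InfinitePlace L // v.IsComplex} × Fin 2)) →₀ ℕ) → ℂ → ℂ),
      (∀ g ∈ W, ∀ k, g k = ∑ i, ((c i).sum fun x a => a * g x) * e i k) ∧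
      (∀ i m, Differentiable ℂ fun w : ℂ => (A i m w)⁻¹) ∧
      (∀ i, ∀ m ∈ ι i, ∀ w : ℂ, 0 < w.re → ∀ k : Matrix.unitaryGroup (Fin 2) (mixedSpace L),
        Integrable (fun x : (mixedSpace L)ˣ => Φ i m (fun l => (x : mixedSpace L) * (k : Matrix (Fin 2) (Fin 2) (mixedSpace L)) 1 l) *
          ((mixedEmbedding.norm ((x : (mixedSpace L)ˣ) : mixedSpace L) : ℝ) : ℂ) ^ w) μ) ∧
      ∀ (i : Fin N) (w : ℂ), 0 < w.re → ∀ k : Matrix.unitaryGroup (Fin 2) (mixedSpace L),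
        e i k = ∑ m ∈ ι i, (A i m w)⁻¹ * ∫ x : (mixedSpace L)ˣ, Φ i m (fun l => (x : mixedSpace L) * (k : Matrix (Fin 2) (Fin 2) (mixedSpace L)) 1 l) *
          ((mixedEmbedding.norm ((x : (mixedSpace L)ˣ) : mixedSpace L) : ℝ) : ℂ) ^ w ∂μ := by
  obtain ⟨N, e, c, heW, hexp⟩ := exists_basis_eval_coords W
  -- the polynomial face of each `e i` (★ (β4-v) C): continuous and `K_∞`-finite because `W` is right-stable
  have hpoly : ∀ i, ∃ P : MvPolynomial (({v : InfinitePlace L // v.IsComplex} × (Fin 2 × Fin 2)) ⊕ ({v : InfinitePlace L // v.IsComplex} × (Fin 2 × Fin 2))) ℂ,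
      ∀ k : Matrix.unitaryGroup (Fin 2) (mixedSpace L), e i k = MvPolynomial.eval
        (Sum.elim (fun w : {v : InfinitePlace L // v.IsComplex} × (Fin 2 × Fin 2) => ((k : Matrix (Fin 2) (Fin 2) (mixedSpace L)) w.2.1 w.2.2).2 w.1)
          (fun w : {v : InfinitePlace L // v.IsComplex} × (Fin 2 × Fin 2) => conj (((k : Matrix (Fin 2) (Fin 2) (mixedSpace L)) w.2.1 w.2.2).2 w.1))) P := by
    intro i
    refine exists_mvPolynomial_of_finiteDimensional_span_rightTranslates_mixedSpace (e i) (hcont _ (heW i)) ?_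
    have hle : Submodule.span ℂ (Set.range fun k₀ : Matrix.unitaryGroup (Fin 2) (mixedSpace L) =>
        fun k : Matrix.unitaryGroup (Fin 2) (mixedSpace L) => e i (k * k₀)) ≤ W :=
      Submodule.span_le.2 (by rintro _ ⟨k₀, rfl⟩; exact hright _ (heW i) k₀)
    exact Submodule.finiteDimensional_of_le hle
  choose P hP using hpoly
  -- ★ (β4-iv) B for each `e i`
  have hB : ∀ i, ∀ p k : Matrix.unitaryGroup (Fin 2) (mixedSpace L), (p : Matrix (Fin 2) (Fin 2) (mixedSpace L)) 1 0 = 0 → e i (p * k) = e i k :=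
    fun i => hflat _ (heW i)
  choose ι Φ A hAinv hgi hval using fun i => exists_godement_arch_of_flat_polynomial_cm μ (e i) (P i) (hP i) (hB i)
  exact ⟨N, e, c, ι, Φ, A, hexp, hAinv, hgi, hval⟩

end Summit.HodgeConjecture.HodgeConjecture.Cruxes.HLiu418.K2LiuUnitaryFlatSpaceGodementData

end
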